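import Literature.AlgebraicGeometry.Motives.ZetaFunctionPoleOrderTateConjecture
import Literature.AlgebraicGeometry.Motives.GaloisRepresentationsDominatedVarieties
import HarnessLib

/-!
# Tate's theorem descends to dominated varieties: `T^r ∧ E^r` for `V` implies it for `U` when
# `f : V ⟶ U`, `f₊ ζ ≠ 0` (Tate 1994 Th. 2.9 with Kleiman 1968 Prop. 1.2.4)

Topic `Literature/AlgebraicGeometry/Motives`; THEOREMS ONLY (no definition, no named fact).

Let `E` be the tree's Galois Weil cohomology theory over a field `k`, `f : V ⟶ U` a morphism of
smooth projective varieties, `dim V = N = M + c = dim U + c`, and suppose `U` is DOMINATED by `V`: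
`f₊ ζ ≠ 0` for some rational algebraic class `ζ ∈ A^c(V)_ℚ` (Kleiman 1968 Prop. 1.2.4; this lane's
`StandardConjecturesDominatedVarieties`: then `f*` is injective, `f₊(f* β ∪ ζ) = q β`, and a class
`x` on `U` is algebraic iff `f* x` is, `mem_(rat)AlgebraicClasses_of_pullback_mem`). Then each
ingredient of Tate's theorem (rows g37-#2 … #4) DESCENDS from `V` to `U` in the same codimension `r`:

* §1 (any Weil cohomology `W`, any field) **`E(r, s + c)` on `V` ⟹ `E(r, s)` on `U`**
  (`homNum_of_pullback_injective`, `homNum_of_pushforward_ne_zero`, `homNum_of_tensor_left`): for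
  `x ∈ Aʳ(U)_ℚ` orthogonal to `Aˢ(U)_ℚ`, `f* x` is orthogonal to `A^{s+c}(V)_ℚ` by the adjunction
  `tr_V(f* x ∪ z) = tr_U(x ∪ f₊ z)` and `f₊ A^{s+c}(V)_ℚ ⊆ Aˢ(U)_ℚ`, so `f* x = 0`, so `x = 0` — the
  bidegree form of the tree's `standardConjectureD_of_pullback_injective`;
* §2 (any `E`, any field, any `g ∈ Γ_k`) **`T_g(r)` descends**: `K·Aʳ(V) = Ker(χ(g)^r g - 1)` on
  `H^{2r}(V)` ⟹ the same on `U` (`algebraicClasses_eq_ker_of_pushforward_ne_zero`; `f*` is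
  equivariant, `ρTwist_pullback`), and **`S_g(r)` descends along any morphism with `f*` injective**
  (`ker_inf_range_eq_bot_of_pullback_injective`);
* §3 (`k` finite) **Tate's `(a) = T^r ∧ E^r` descends** (`tate_a_of_pushforward_ne_zero`), hence
  **`(c)`: `ρ_r(U) = dim H^{2r}(U)(r)_1`** (`rank_eq_finrank_maxGenEigenspace_of_pushforward_ne_zero`)
  and, under the trace formula, `χ(φ) = q` and RH for `U`, **the pole form**: `Z(U, t)` has at
  `t = q^{-r}` a pole of order exactly `ρ_r(U)` (`hasPoleOfOrderAt_zetaSeries_rank_of_pushforward_ne_zero`);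
  the factors of a product: `(a)` for `X × Z` in codimension `r` ⟹ `(a)` for `X` and for `Z`
  (`tate_a_of_tensor_left/right`).

Sources: J. Tate, PSPM 55.1 (1994) §2 Th. 2.9 (through B. Kahn, *Zeta and L-functions of
varieties and motives* (2020) §6.14 Th. 6.53 and J. S. Milne, arXiv:0709.3040 Th. 1.2 — Milne,
ibid. §1: «The Tate conjecture holds for … products …», Th. 1.4/2.x reductions along dominant
maps); S. Kleiman, *Algebraic cycles and the Weil conjectures* (1968) §1.2 Prop. 1.2.4 («if `X` is
dominated by `Y` … `f*` is injective») and §3 (the conjectures are stable under such `f`);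
B. Kahn (2020) §3.5.1 (projection formula, `f₊` adjoint to `f*`). The descent of the `Γ_k`-form
`E.TateConjectureFor` and of `W.StandardConjectureD` along dominations is this lane's
`TateConjectureDominatedVarieties` / `StandardConjecturesDominatedVarieties` (generation 36).

## Provenance

Lane `lit-hodgefound` (summit `HodgeConjecture`, Track 2 foundations library, Layer B: motives),
seat `lit-hodgefound-p29` (literature-prover, generation 37, row g37-#6).
-/

universe u v

open CategoryTheory AlgebraicGeometry MonoidalCategory CartesianMonoidalCategory Polynomial

noncomputable section

namespace Literature.AlgebraicGeometry.Motives

open Literature.LinearAlgebra Literature.AlgebraicGeometry.Kahn2003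

/-! ## §1 `E(r, ·)` descends along dominations -/

namespace WeilCohomology

variable {k : Type u} [Field k] {K : Type v} [Field K] [CharZero K] (W : WeilCohomology k K)
variable {N M n m c : ℕ} {V U X Z : SchemeOver k}

/-- **`E(r, s + c)` on `V` ⟹ `E(r, s)` on `U` along `f : V ⟶ U` with `f*` injective on `H^{2r}`**
(`dim V = dim U + c`): an `x ∈ Aʳ(U)_ℚ` orthogonal to `Aˢ(U)_ℚ` has `f* x ∈ Aʳ(V)_ℚ` orthogonal to
`A^{s+c}(V)_ℚ` — `tr_V(f* x ∪ z) = tr_U(x ∪ f₊ z)` and `f₊ z ∈ Aˢ(U)_ℚ` — hence `f* x = 0`.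
[cite: Kleiman1968AlgebraicCycles, §1.2 Prop. 1.2.4 and §3] [cite: Kahn2020, §3.5.1] -/
theorem homNum_of_pullback_injective (hV : IsSmoothProjective N V) (hU : IsSmoothProjective M U)
    (f : V ⟶ U) (hc : M + c = N) {r s : ℕ} (h : 2 * r + 2 * s = 2 * M)
    (h' : 2 * r + 2 * (s + c) = 2 * N) (hinj : Function.Injective (W.pullback f (2 * r)))
    (hE : ∀ x ∈ W.ratAlgebraicClasses V r, (∀ y ∈ W.ratAlgebraicClasses V (s + c),
      W.cupPairing V N (2 * r) (2 * (s + c)) h' x y = 0) → x = 0) :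
    ∀ x ∈ W.ratAlgebraicClasses U r, (∀ y ∈ W.ratAlgebraicClasses U s,
      W.cupPairing U M (2 * r) (2 * s) h x y = 0) → x = 0 := by
  intro x hx hperp
  refine hinj ?_
  rw [map_zero]
  refine hE _ (W.pullback_ratAlgebraicClasses_le hV hU f r ⟨x, hx, rfl⟩) fun y hy ↦ ?_
  have hmem := W.pushforward_mem_ratAlgebraicClasses hV hU f (a := s + c) (b := s) (d' := 2 * r)
    (by omega) (by omega) hy
  have h0 := hperp _ hmem
  rw [W.cupPairing_apply] at h0 ⊢
  rw [W.trace_pullback_cup_eq hV hU f (by omega : 2 * (s + c) + 2 * r = 2 * N)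
    (by omega : 2 * s + 2 * r = 2 * M) _ (by omega) x y]
  exact h0

/-- **`E(r, s + c)(V) ⟹ E(r, s)(U)` for `U` dominated by `V`** (`f₊ ζ ≠ 0`, `ζ ∈ A^c(V)_ℚ`, so
`f*` is injective, Kleiman Prop. 1.2.4). [cite: Kleiman1968AlgebraicCycles, §1.2 Prop. 1.2.4 and §3] -/
theorem homNum_of_pushforward_ne_zero (hV : IsSmoothProjective N V) (hU : IsSmoothProjective M U)
    (f : V ⟶ U) {ζ : W.obj V (2 * c)} (hζ : ζ ∈ W.ratAlgebraicClasses V c)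
    {he : 2 * c + 2 * M = 2 * N} {hd : 0 + 2 * M = 2 * M}
    (hne : W.pushforward (N := N) hU f he hd ζ ≠ 0) {r s : ℕ} (h : 2 * r + 2 * s = 2 * M)
    (h' : 2 * r + 2 * (s + c) = 2 * N)
    (hE : ∀ x ∈ W.ratAlgebraicClasses V r, (∀ y ∈ W.ratAlgebraicClasses V (s + c),
      W.cupPairing V N (2 * r) (2 * (s + c)) h' x y = 0) → x = 0) :
    ∀ x ∈ W.ratAlgebraicClasses U r, (∀ y ∈ W.ratAlgebraicClasses U s,
      W.cupPairing U M (2 * r) (2 * s) h x y = 0) → x = 0 :=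
  W.homNum_of_pullback_injective hV hU f (by omega) h h'
    (W.pullback_injective_of_pushforward_ne_zero hV hU f hζ hne (2 * r)) hE

/-- **`E(r, s + m)(X × Z) ⟹ E(r, s)(X)`** (`dim Z = m`; `X` is dominated by `X × Z`).
[cite: Kleiman1968AlgebraicCycles, §1.2 Prop. 1.2.4 and §3] -/
theorem homNum_of_tensor_left (hX : IsSmoothProjective n X) (hZ : IsSmoothProjective m Z)
    {r s : ℕ} (h : 2 * r + 2 * s = 2 * n) (h' : 2 * r + 2 * (s + m) = 2 * (n + m))
    (hE : ∀ x ∈ W.ratAlgebraicClasses (X ⊗ Z) r, (∀ y ∈ W.ratAlgebraicClasses (X ⊗ Z) (s + m),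
      W.cupPairing (X ⊗ Z) (n + m) (2 * r) (2 * (s + m)) h' x y = 0) → x = 0) :
    ∀ x ∈ W.ratAlgebraicClasses X r, (∀ y ∈ W.ratAlgebraicClasses X s,
      W.cupPairing X n (2 * r) (2 * s) h x y = 0) → x = 0 :=
  W.homNum_of_pullback_injective (IsSmoothProjective.tensor_holds hX hZ) hX (fst X Z) rfl h h'
    (W.pullback_fst_injective hX hZ (2 * r)) hE

end WeilCohomology

/-! ## §2 `T_g(r)` and `S_g(r)` descend -/

namespace GaloisWeilCohomology

variable {k : Type u} [Field k] {K : Type v} [Field K] [CharZero K]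
  {χ : Field.absoluteGaloisGroup k →* Kˣ} (E : GaloisWeilCohomology k K χ)
variable {N M n m c : ℕ} {V U X Z : SchemeOver k}

/-- **`f*` maps `Ker(χ(g)^j g - 1)` on `Hⁱ(U)` into `Ker(χ(g)^j g - 1)` on `Hⁱ(V)`** (`f*` is
equivariant, `ρTwist_pullback`). [cite: Tate1994, §1] -/
theorem pullback_mem_ker_sub_one (hV : IsSmoothProjective N V) (hU : IsSmoothProjective M U)
    (f : V ⟶ U) {i : ℕ} {j : ℤ} (g : Field.absoluteGaloisGroup k) {x : E.obj U i}
    (hx : x ∈ LinearMap.ker (E.ρTwist U i j g - 1)) :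
    E.pullback f i x ∈ LinearMap.ker (E.ρTwist V i j g - 1) := by
  rw [LinearMap.mem_ker, LinearMap.sub_apply, Module.End.one_apply, sub_eq_zero] at hx ⊢
  rw [E.ρTwist_pullback hV hU f i j g x, hx]

/-- **`T_g(r)` descends to dominated varieties**: if `K·Aʳ(V) = Ker(χ(g)^r g - 1)` on `H^{2r}(V)`
and `U` is dominated by `V` (`f₊ ζ ≠ 0`), then `K·Aʳ(U) = Ker(χ(g)^r g - 1)` on `H^{2r}(U)`: for `x`
fixed, `f* x` is fixed, hence algebraic, hence `x` is algebraic (`mem_algebraicClasses_of_pullback_mem`).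
[cite: Tate1994, §1 and §2 Th. 2.9] [cite: Kleiman1968AlgebraicCycles, §1.2 Prop. 1.2.4] -/
theorem algebraicClasses_eq_ker_of_pushforward_ne_zero (hV : IsSmoothProjective N V)
    (hU : IsSmoothProjective M U) (f : V ⟶ U) {ζ : E.obj V (2 * c)}
    (hζ : ζ ∈ E.ratAlgebraicClasses V c) {he : 2 * c + 2 * M = 2 * N} {hd : 0 + 2 * M = 2 * M}
    (hne : E.pushforward (N := N) hU f he hd ζ ≠ 0) {r : ℕ} (g : Field.absoluteGaloisGroup k)
    (hT : E.algebraicClasses V r = LinearMap.ker (E.ρTwist V (2 * r) r g - 1)) :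
    E.algebraicClasses U r = LinearMap.ker (E.ρTwist U (2 * r) r g - 1) := by
  refine le_antisymm (E.algebraicClasses_le_ker_sub_one hU r g) fun x hx ↦ ?_
  refine E.mem_algebraicClasses_of_pullback_mem hV hU f hζ hne ?_
  rw [hT]
  exact E.pullback_mem_ker_sub_one hV hU f g hx

/-- **`S_g(r)` descends along any morphism with `f*` injective on `H^{2r}`**: `Ker ∩ Range` of
`χ(g)^r g - 1` on `H^{2r}(U)` is mapped by the equivariant injective `f*` into `Ker ∩ Range` on
`H^{2r}(V)`. [cite: Kahn2020, §6.14 Th. 6.53] [cite: Kleiman1968AlgebraicCycles, §1.2 Prop. 1.2.4] -/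
theorem ker_inf_range_eq_bot_of_pullback_injective (hV : IsSmoothProjective N V)
    (hU : IsSmoothProjective M U) (f : V ⟶ U) {i : ℕ} {j : ℤ} (g : Field.absoluteGaloisGroup k)
    (hinj : Function.Injective (E.pullback f i))
    (hS : LinearMap.ker (E.ρTwist V i j g - 1) ⊓ LinearMap.range (E.ρTwist V i j g - 1) = ⊥) :
    LinearMap.ker (E.ρTwist U i j g - 1) ⊓ LinearMap.range (E.ρTwist U i j g - 1) = ⊥ := by
  refine (Submodule.eq_bot_iff _).mpr fun x hx ↦ ?_
  obtain ⟨hx₁, ⟨y, rfl⟩⟩ := hx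
  apply hinj
  rw [map_zero]
  have hmem : E.pullback f i ((E.ρTwist U i j g - 1) y) ∈
      LinearMap.ker (E.ρTwist V i j g - 1) ⊓ LinearMap.range (E.ρTwist V i j g - 1) := by
    refine ⟨E.pullback_mem_ker_sub_one hV hU f g hx₁, ⟨E.pullback f i y, ?_⟩⟩
    rw [LinearMap.sub_apply, Module.End.one_apply, LinearMap.sub_apply, Module.End.one_apply,
      map_sub, E.ρTwist_pullback hV hU f i j g y]
  rw [hS] at hmem
  simpa using hmem

/-- **`S_g(r)` descends to dominated varieties** (`f₊ ζ ≠ 0` makes `f*` injective).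
[cite: Kahn2020, §6.14 Th. 6.53] [cite: Kleiman1968AlgebraicCycles, §1.2 Prop. 1.2.4] -/
theorem ker_inf_range_eq_bot_of_pushforward_ne_zero (hV : IsSmoothProjective N V)
    (hU : IsSmoothProjective M U) (f : V ⟶ U) {ζ : E.obj V (2 * c)}
    (hζ : ζ ∈ E.ratAlgebraicClasses V c) {he : 2 * c + 2 * M = 2 * N} {hd : 0 + 2 * M = 2 * M}
    (hne : E.pushforward (N := N) hU f he hd ζ ≠ 0) {i : ℕ} {j : ℤ}
    (g : Field.absoluteGaloisGroup k)
    (hS : LinearMap.ker (E.ρTwist V i j g - 1) ⊓ LinearMap.range (E.ρTwist V i j g - 1) = ⊥) :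
    LinearMap.ker (E.ρTwist U i j g - 1) ⊓ LinearMap.range (E.ρTwist U i j g - 1) = ⊥ :=
  E.ker_inf_range_eq_bot_of_pullback_injective hV hU f g
    (E.pullback_injective_of_pushforward_ne_zero hV hU f hζ hne i) hS

variable [Finite k]

/-! ## §3 Over a finite field: Tate's `(a)`, `(c)` and the pole statement descend -/

/-- **Tate's `(a) = T^r ∧ E^r` descends to dominated varieties**: for `f : V ⟶ U` with `f₊ ζ ≠ 0`
(`ζ ∈ A^c(V)_ℚ`, `dim V = dim U + c`), if `K·Aʳ(V) = Ker(φ_r - 1)` and `E(r, s + c)` holds on `V`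
(`r + s = dim U`), then `K·Aʳ(U) = Ker(φ_r - 1)` and `E(r, s)` holds on `U`.
[cite: Tate1994, §2 Th. 2.9] [cite: Kleiman1968AlgebraicCycles, §1.2 Prop. 1.2.4 and §3] -/
theorem tate_a_of_pushforward_ne_zero (hV : IsSmoothProjective N V) (hU : IsSmoothProjective M U)
    (f : V ⟶ U) {ζ : E.obj V (2 * c)} (hζ : ζ ∈ E.ratAlgebraicClasses V c)
    {he : 2 * c + 2 * M = 2 * N} {hd : 0 + 2 * M = 2 * M}
    (hne : E.pushforward (N := N) hU f he hd ζ ≠ 0) {r s : ℕ} (h : 2 * r + 2 * s = 2 * M)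
    (h' : 2 * r + 2 * (s + c) = 2 * N)
    (hT : E.algebraicClasses V r = LinearMap.ker (E.ρTwist V (2 * r) r (geomFrob k) - 1))
    (hE : ∀ x ∈ E.ratAlgebraicClasses V r, (∀ y ∈ E.ratAlgebraicClasses V (s + c),
      E.cupPairing V N (2 * r) (2 * (s + c)) h' x y = 0) → x = 0) :
    E.algebraicClasses U r = LinearMap.ker (E.ρTwist U (2 * r) r (geomFrob k) - 1) ∧
      ∀ x ∈ E.ratAlgebraicClasses U r, (∀ y ∈ E.ratAlgebraicClasses U s,
        E.cupPairing U M (2 * r) (2 * s) h x y = 0) → x = 0 :=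
  ⟨E.algebraicClasses_eq_ker_of_pushforward_ne_zero hV hU f hζ hne (geomFrob k) hT,
    E.homNum_of_pushforward_ne_zero hV hU f hζ hne h h' hE⟩

/-- **Tate's `(c)` descends: `ρ_r(V) = dim H^{2r}(V)(r)_1 ⟹ ρ_r(U) = dim H^{2r}(U)(r)_1`** for `U`
dominated by `V` («the order of the pole equals the rank of the numerical classes» passes from
`V` to `U`). [cite: Tate1994, §2 Th. 2.9] [cite: Kahn2020, §6.14 Th. 6.53]
[cite: Kleiman1968AlgebraicCycles, §1.2 Prop. 1.2.4] -/
theorem rank_eq_finrank_maxGenEigenspace_of_pushforward_ne_zero (hV : IsSmoothProjective N V)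
    (hU : IsSmoothProjective M U) (f : V ⟶ U) {ζ : E.obj V (2 * c)}
    (hζ : ζ ∈ E.ratAlgebraicClasses V c) {he : 2 * c + 2 * M = 2 * N} {hd : 0 + 2 * M = 2 * M}
    (hne : E.pushforward (N := N) hU f he hd ζ ≠ 0) {r s : ℕ} (hrs : r + s = M)
    (h : 2 * r + 2 * s = 2 * M) (h' : 2 * r + 2 * (s + c) = 2 * N)
    (hc : Module.finrank K (LinearMap.range ((E.cupPairing V N (2 * r) (2 * (s + c)) h').domRestrict₁₂
          (E.algebraicClasses V r) (E.algebraicClasses V (s + c)))) =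
        Module.finrank K (Module.End.maxGenEigenspace (E.ρTwist V (2 * r) r (geomFrob k)) 1)) :
    Module.finrank K (LinearMap.range ((E.cupPairing U M (2 * r) (2 * s) h).domRestrict₁₂
          (E.algebraicClasses U r) (E.algebraicClasses U s))) =
        Module.finrank K (Module.End.maxGenEigenspace (E.ρTwist U (2 * r) r (geomFrob k)) 1) := by
  obtain ⟨hT, hE⟩ := (E.rank_eq_finrank_maxGenEigenspace_iff hV (by omega) h').mp hc
  exact (E.rank_eq_finrank_maxGenEigenspace_iff hU hrs h).mpr
    (E.tate_a_of_pushforward_ne_zero hV hU f hζ hne h h' hT hE)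

/-- **The pole statement descends**: if `Z(V, t)` has at `t = q^{-r}` a pole of order `ρ_r(V)`
(trace formula, `χ(φ) = q`, RH for `V` and for `U`), then `Z(U, t)` has at `t = q^{-r}` a pole of
order `ρ_r(U)`, for `U` dominated by `V`. [cite: Tate1994, §2 Th. 2.9]
[cite: Milne2007TateFiniteFieldsAIM, Th. 1.2] [cite: Kleiman1968AlgebraicCycles, §1.2 Prop. 1.2.4] -/
theorem hasPoleOfOrderAt_zetaSeries_rank_of_pushforward_ne_zero (hE : E.HasLefschetzTraceFormula)
    (hχ : ((χ (arithFrob k) : Kˣ) : K) = Nat.card k) (hV : IsSmoothProjective N V)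
    (hU : IsSmoothProjective M U) (hRHV : E.WeilRiemannHypothesisFor V N)
    (hRHU : E.WeilRiemannHypothesisFor U M) (f : V ⟶ U) {ζ : E.obj V (2 * c)}
    (hζ : ζ ∈ E.ratAlgebraicClasses V c) {he : 2 * c + 2 * M = 2 * N} {hd : 0 + 2 * M = 2 * M}
    (hne : E.pushforward (N := N) hU f he hd ζ ≠ 0) {r s : ℕ} (hrs : r + s = M)
    (h : 2 * r + 2 * s = 2 * M) (h' : 2 * r + 2 * (s + c) = 2 * N)
    (hc : HasPoleOfOrderAt (zetaSeries V) (((Nat.card k : ℚ) ^ r)⁻¹)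
        (Module.finrank K (LinearMap.range ((E.cupPairing V N (2 * r) (2 * (s + c)) h').domRestrict₁₂
          (E.algebraicClasses V r) (E.algebraicClasses V (s + c)))))) :
    HasPoleOfOrderAt (zetaSeries U) (((Nat.card k : ℚ) ^ r)⁻¹)
        (Module.finrank K (LinearMap.range ((E.cupPairing U M (2 * r) (2 * s) h).domRestrict₁₂
          (E.algebraicClasses U r) (E.algebraicClasses U s)))) := by
  obtain ⟨hT, hEr⟩ := (E.hasPoleOfOrderAt_zetaSeries_rank_iff hE hχ hV hRHV (by omega) h').mp hc
  exact (E.hasPoleOfOrderAt_zetaSeries_rank_iff hE hχ hU hRHU hrs h).mpr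
    (E.tate_a_of_pushforward_ne_zero hV hU f hζ hne h h' hT hEr)

/-- **Tate's `(a)` for `X × Z` in codimension `r` implies `(a)` for `X`** (`X` is dominated by
`X × Z`: `pr_X`, `ζ = pr_Z^* b` with `tr_Z b = 1`). [cite: Tate1994, §2 Th. 2.9]
[cite: Milne2007TateFiniteFieldsAIM, Th. 1.2] [cite: Kleiman1968AlgebraicCycles, §1.2 Prop. 1.2.4] -/
theorem tate_a_of_tensor_left (hX : IsSmoothProjective n X) (hZ : IsSmoothProjective m Z)
    {r s : ℕ} (h : 2 * r + 2 * s = 2 * n) (h' : 2 * r + 2 * (s + m) = 2 * (n + m))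
    (hT : E.algebraicClasses (X ⊗ Z) r =
      LinearMap.ker (E.ρTwist (X ⊗ Z) (2 * r) r (geomFrob k) - 1))
    (hE : ∀ x ∈ E.ratAlgebraicClasses (X ⊗ Z) r, (∀ y ∈ E.ratAlgebraicClasses (X ⊗ Z) (s + m),
      E.cupPairing (X ⊗ Z) (n + m) (2 * r) (2 * (s + m)) h' x y = 0) → x = 0) :
    E.algebraicClasses X r = LinearMap.ker (E.ρTwist X (2 * r) r (geomFrob k) - 1) ∧
      ∀ x ∈ E.ratAlgebraicClasses X r, (∀ y ∈ E.ratAlgebraicClasses X s,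
        E.cupPairing X n (2 * r) (2 * s) h x y = 0) → x = 0 := by
  obtain ⟨ζ, hζ, hne⟩ := E.exists_pushforward_fst_ne_zero hX hZ
    (by omega : 2 * m + 2 * n = 2 * (n + m)) (Nat.zero_add _)
  exact E.tate_a_of_pushforward_ne_zero (IsSmoothProjective.tensor_holds hX hZ) hX (fst X Z) hζ hne
    h h' hT hE

/-- **`(c)` for `X × Z` in codimension `r` implies `(c)` for `X`.** [cite: Tate1994, §2 Th. 2.9]
[cite: Kahn2020, §6.14 Th. 6.53] -/
theorem rank_eq_finrank_maxGenEigenspace_of_tensor_left (hX : IsSmoothProjective n X)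
    (hZ : IsSmoothProjective m Z) {r s : ℕ} (hrs : r + s = n) (h : 2 * r + 2 * s = 2 * n)
    (h' : 2 * r + 2 * (s + m) = 2 * (n + m))
    (hc : Module.finrank K (LinearMap.range
          ((E.cupPairing (X ⊗ Z) (n + m) (2 * r) (2 * (s + m)) h').domRestrict₁₂
            (E.algebraicClasses (X ⊗ Z) r) (E.algebraicClasses (X ⊗ Z) (s + m)))) =
        Module.finrank K
          (Module.End.maxGenEigenspace (E.ρTwist (X ⊗ Z) (2 * r) r (geomFrob k)) 1)) :
    Module.finrank K (LinearMap.range ((E.cupPairing X n (2 * r) (2 * s) h).domRestrict₁₂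
          (E.algebraicClasses X r) (E.algebraicClasses X s))) =
        Module.finrank K (Module.End.maxGenEigenspace (E.ρTwist X (2 * r) r (geomFrob k)) 1) := by
  obtain ⟨ζ, hζ, hne⟩ := E.exists_pushforward_fst_ne_zero hX hZ
    (by omega : 2 * m + 2 * n = 2 * (n + m)) (Nat.zero_add _)
  exact E.rank_eq_finrank_maxGenEigenspace_of_pushforward_ne_zero (IsSmoothProjective.tensor_holds hX hZ)
    hX (fst X Z) hζ hne hrs h h' hc

end GaloisWeilCohomology

end Literature.AlgebraicGeometry.Motives

end
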